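import Literature.Probability.RandomPlanarGeometry.SLEOnePointMartingaleProofs
import Literature.Probability.RandomPlanarGeometry.SLETwoPointMartingaleProofs
import Literature.Probability.RandomPlanarGeometry.SwallowingProbCalculus
import Literature.Analysis.FunctionSpaces.ItoProductRule
import HarnessLib

/-!
# Lawler's two-point martingale for the real SLE_κ flow (the Itô step proved); Cardy's formula for SLE₆

Topic `Probability/RandomPlanarGeometry`; theorems only. This file discharges the last
stochastic-calculus input of Cardy's formula for SLE₆ in the tree and assembles the target:

* `Literature.Probability.RandomPlanarGeometry.sle_martingale_twoPointObservable_holds` — the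
  named fact of `SLETwoPointMartingale` (Lawler (2005), §6.7, proof of Prop. 6.33, the Itô step):
  for `κ > 4` and `y < 0 < x`, Lawler's two-point observable `ψ(Z_{t∧σ})` of the real SLE_κ flow
  (`Z = X/(X - Y)`, `σ = T_x ∧ T_y`, regularised from `σ` on) is a martingale of the raw Brownian
  filtration under the (pre-)Wiener measure;
* `Literature.Probability.RandomPlanarGeometry.sle_six_measureReal_hitsBefore_holds` — **Cardy's
  formula for SLE₆ in a conformal rectangle** (`CritPerc.sle_six_measureReal_hitsBefore` of
  `CritPercSLE`; Werner (2007), §3; Lawler–Schramm–Werner (2001); Smirnov (2001)), by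
  `sle_six_measureReal_hitsBefore_of_itoSteps` (`SLEOnePointSwallowingProofs`) from the three Itô
  steps: this file's two-point martingale and the one-point martingales
  `sle_martingale_onePointPow_holds`, `sle_martingale_onePointSq_holds`
  (`SLEOnePointMartingaleProofs`).

## The proof of the two-point martingale (Lawler, proof of Prop. 6.33, made rigorous as in his footnote 2)

Fix levels `0 < δ < z₀ = x/(x-y) < 1 - δ` and let `ρ` be the exit time of the (continuous,
adapted: `SLECrossingProbabilityProofs`, `SLETwoPointMartingaleProofs`) observable `M = ψ(Z̃)` from
`(ψ δ, ψ(1-δ))`; since `ψ = swallowingPsi (2/κ)` is a strictly increasing homeomorphism of `[0, 1]`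
(`SwallowingProbCalculus`), up to `ρ` we are strictly before `σ` and `Z ∈ [δ, 1-δ]`
(`lt_twoPointTime_and_twoPointRatio_mem_Icc`), so `X ≥ δ(x-y)`, `-Y ≥ δ(x-y)` and the gap
`X - Y = (x-y) + ∫(2/X - 2/Y) ds` (pathwise integrated Loewner equation, `SLERealFlowIto`) grows at
most linearly. The stopped flows `X^ρ`, `Y^ρ` are Itô processes `dX = (2/X)dt - √κ dB`
(`isItoProcess_stoppedProcess_sleRealFlowStop`); `A = 1/(X^ρ - Y^ρ)` is a time integral
(`Literature.Analysis.FunctionSpaces.inv_eq_inv_add_timeIntegral`, fundamental theorem of calculus);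
the product rule (`Literature.Analysis.FunctionSpaces.IsItoProcess.mul_timeIntegral`, with the
square-integrable Itô integrals of the bounded progressive integrands `σ'X^ρ`, `σ'A`) makes
`Z^ρ = X^ρ A` an Itô process ("the product rule gives `dZ = …`"); and for a `C²` function `f` equal to
`ψ` near `[δ, 1-δ]` (`Literature.Analysis.Calculus.exists_contDiff_eqOn_Icc`, `contDiffOn_swallowingPsi`)
the Itô drift of `f(Z^ρ)` vanishes identically by the hypergeometric equation (6.21)
(`lawler_drift_identity`, with `ψ'`, `ψ''` from `hasDerivAt_swallowingPsi`,
`hasDerivAt_deriv_swallowingPsi`), so `f(Z^ρ) = M^ρ` is a martingale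
(`Literature.Analysis.FunctionSpaces.martingale_apply_of_itoDrift_eq_zero`, Itô's formula for Itô
processes, `ItoFormulaProofs`). Finally the levels `δₙ ↓ 0`: the stopped observables are bounded by
`1` and converge to `M` along every path (`tendsto_stoppedProcess_sleTwoPointObservable`: either
`t ≤ ρₙ` eventually, or the exit values `ψ(δₙ) → 0`, `ψ(1-δₙ) → 1` force `M_ℓ(1 - M_ℓ) = 0` at the
limit clock `ℓ`, whence `σ ≤ ℓ` and `M` is constant on `[σ, ∞) ∋ ℓ, t`), and bounded pointwise limits
of martingales are martingales (`Literature.Probability.Process.martingale_of_tendsto_of_abs_le'`).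

## References

* G. F. Lawler, *Conformally Invariant Processes in the Plane*, AMS (2005), §6.7, Prop. 6.33 and
  its proof (eq. (6.21), footnote 2); §1.10, proof of Prop. 1.21.
* W. Werner, *Lectures on two-dimensional critical percolation*, IAS/Park City (2007), §3
  (Cardy's formula for SLE₆).
* G. Lawler, O. Schramm, W. Werner, *Values of Brownian intersection exponents I*, Acta Math. 187
  (2001), §3; S. Smirnov, C. R. Acad. Sci. Paris 333 (2001).
* D. Revuz, M. Yor, *Continuous Martingales and Brownian Motion* (3rd ed., 1999), Ch. IV,
  Prop. (3.1), Thm (3.3).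
-/

noncomputable section

open MeasureTheory Filter Topology Set
open scoped NNReal ENNReal

namespace Literature.Analysis.FunctionSpaces

variable {Ω : Type*} {G : ℝ≥0 → Ω → ℝ} {ρ : Ω → WithTop ℝ≥0} {c : ℝ} {ω : Ω}

/-- On `[0, T]` with `↑T ≤ ρ ω`, the truncated path is the path. [folklore] -/
theorem trunc_toNNReal_eq_of_le {T : ℝ≥0} (hT : (T : WithTop ℝ≥0) ≤ ρ ω) {s : ℝ}
    (hs : s ∈ Icc (0 : ℝ) T) : trunc ρ G s.toNNReal ω = G s.toNNReal ω :=
  trunc_of_le ((WithTop.coe_le_coe.2 (Real.toNNReal_le_iff_le_coe.2 hs.2)).trans hT)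

/-- **Reciprocal of a truncated time integral** (pathwise calculus). Let `s ↦ G_s(ω)` be
continuous, `ρ` a random time, and suppose `F_t = c + ∫₀ᵗ 𝟙_{s ≤ ρ} G_s ds > 0` for all `t`.
Then `1/F_t = 1/c + ∫₀ᵗ 𝟙_{s ≤ ρ} (-G_s / F_s²) ds` for all `t`: the fundamental theorem of
calculus for `1/F` on `[0, t ∧ ρ]` (where `F' = G`), and constancy of both sides after `ρ`. This
is the finite-variation factor `1/(X_t - Y_t)` of Lawler's ratio `Z = X/(X - Y)`
(`d[X - Y] = (a/X - a/Y) dt`, proof of Prop. 6.33). [folklore] -/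
theorem inv_eq_inv_add_timeIntegral (hG : Continuous fun s ↦ G s ω)
    (hpos : ∀ t, 0 < c + timeIntegral (trunc ρ G) t ω) (t : ℝ≥0) :
    (c + timeIntegral (trunc ρ G) t ω)⁻¹ = c⁻¹ +
      timeIntegral (trunc ρ fun s ω ↦ -G s ω / (c + timeIntegral (trunc ρ G) s ω) ^ 2) t ω := by
  have hc : 0 < c := by simpa [timeIntegral] using hpos 0
  -- the continuous path and its primitive
  set g : ℝ → ℝ := fun s ↦ G s.toNNReal ω with hgdef
  have hg : Continuous g := hG.comp continuous_real_toNNReal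
  set F₀ : ℝ → ℝ := fun s ↦ c + ∫ r in (0 : ℝ)..s, g r with hF₀def
  have hF₀d : ∀ s, HasDerivAt F₀ (g s) s := fun s ↦
    ((hg.integral_hasStrictDerivAt 0 s).hasDerivAt).const_add c
  have hF₀c : Continuous F₀ := continuous_iff_continuousAt.2 fun s ↦ (hF₀d s).continuousAt
  -- Step 1: the identity up to a time `T` with `↑T ≤ ρ ω`
  have step : ∀ T : ℝ≥0, (T : WithTop ℝ≥0) ≤ ρ ω →
      (c + timeIntegral (trunc ρ G) T ω)⁻¹ = c⁻¹ +
        timeIntegral (trunc ρ fun s ω ↦ -G s ω / (c + timeIntegral (trunc ρ G) s ω) ^ 2) T ω := by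
    intro T hT
    -- on `[0, T]`, `F = F₀`
    have hFT : ∀ s ∈ Icc (0 : ℝ) T, c + timeIntegral (trunc ρ G) s.toNNReal ω = F₀ s := by
      intro s hs
      simp only [timeIntegral, hF₀def, Real.coe_toNNReal _ hs.1]
      congr 1
      refine intervalIntegral.integral_congr fun r hr ↦ ?_
      rw [uIcc_of_le hs.1] at hr
      exact trunc_toNNReal_eq_of_le hT ⟨hr.1, hr.2.trans hs.2⟩
    have hF₀pos : ∀ s ∈ Icc (0 : ℝ) T, 0 < F₀ s := fun s hs ↦ by
      rw [← hFT s hs]; exact hpos _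
    -- FTC for `1/F₀` on `[0, T]`
    have hderiv : ∀ s ∈ Ioo (0 : ℝ) T, HasDerivAt (fun s ↦ (F₀ s)⁻¹) (-(g s) / (F₀ s) ^ 2) s :=
      fun s hs ↦ (hF₀d s).inv (hF₀pos s ⟨hs.1.le, hs.2.le⟩).ne'
    have hcont : ContinuousOn (fun s ↦ (F₀ s)⁻¹) (Icc 0 T) :=
      hF₀c.continuousOn.inv₀ fun s hs ↦ (hF₀pos s hs).ne'
    have hcont' : ContinuousOn (fun s ↦ -(g s) / (F₀ s) ^ 2) (Icc 0 T) :=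
      hg.continuousOn.neg.div (hF₀c.continuousOn.pow 2) fun s hs ↦ (pow_pos (hF₀pos s hs) 2).ne'
    have hFTC := intervalIntegral.integral_eq_sub_of_hasDerivAt_of_le T.coe_nonneg hcont hderiv
      (hcont'.intervalIntegrable_of_Icc T.coe_nonneg)
    -- rewrite both sides
    have hL : c + timeIntegral (trunc ρ G) T ω = F₀ T := by
      have := hFT T ⟨T.coe_nonneg, le_rfl⟩
      rwa [Real.toNNReal_coe] at this
    have hR : timeIntegral (trunc ρ fun s ω ↦ -G s ω / (c + timeIntegral (trunc ρ G) s ω) ^ 2) T ω =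
        ∫ s in (0 : ℝ)..T, -(g s) / (F₀ s) ^ 2 := by
      simp only [timeIntegral]
      refine intervalIntegral.integral_congr fun s hs ↦ ?_
      rw [uIcc_of_le T.coe_nonneg] at hs
      have h1 := hFT s hs
      simp only [timeIntegral] at h1
      rw [trunc_toNNReal_eq_of_le hT hs, h1]
    have h0 : F₀ 0 = c := by simp [hF₀def]
    rw [hL, hR, hFTC, h0]
    ring
  -- Step 2: the general case
  by_cases ht : (t : WithTop ℝ≥0) ≤ ρ ω
  · exact step t ht
  · rw [not_le] at ht
    obtain ⟨r₀, hr₀⟩ := WithTop.ne_top_iff_exists.1 ht.ne_top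
    have hr₀t : r₀ < t := by rw [← hr₀] at ht; exact WithTop.coe_lt_coe.1 ht
    have hr₀le : (r₀ : WithTop ℝ≥0) ≤ ρ ω := by rw [hr₀]
    have hstep := step r₀ hr₀le
    -- both time integrals are constant after `ρ`
    have hconst : ∀ (H : ℝ≥0 → Ω → ℝ), timeIntegral (trunc ρ H) t ω = timeIntegral (trunc ρ H) r₀ ω := by
      intro H
      rw [timeIntegral_trunc, timeIntegral_trunc, ← hr₀, min_self,
        min_eq_right (WithTop.coe_le_coe.2 hr₀t.le)]
    rw [hconst, hconst]
    exact hstep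

end Literature.Analysis.FunctionSpaces

namespace Literature.Probability.RandomPlanarGeometry

open Loewner Literature.Probability.Process Literature.Analysis.FunctionSpaces
  Literature.Analysis.Calculus

/-! ### `ψ` is `C²` on `(0, 1)` -/

section Psi

variable {a : ℝ}

/-- The kernel `u^{-2a}(1-u)^{-2a}` is smooth on `(0, 1)`. [folklore] -/
theorem contDiffOn_swallowingKernel (a : ℝ) {n : ℕ∞} :
    ContDiffOn ℝ n (swallowingKernel a) (Ioo 0 1) := by
  intro u hu
  have h1 : ContDiffAt ℝ n (fun u : ℝ ↦ u ^ (-(2 * a))) u :=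
    Real.contDiffAt_rpow_const_of_ne hu.1.ne'
  have h2 : ContDiffAt ℝ n (fun u : ℝ ↦ (1 - u) ^ (-(2 * a))) u :=
    (Real.contDiffAt_rpow_const_of_ne (by linarith [hu.2] : (1 - u) ≠ 0)).comp u
      (contDiffAt_const.sub contDiffAt_id)
  exact (h1.mul h2).contDiffWithinAt

/-- **Lawler's `ψ` is `C²` on `(0, 1)`** (its derivative there is the smooth kernel divided by the
complete integral). [cite: Lawler2005, Prop. 6.33] -/
theorem contDiffOn_swallowingPsi (ha : a < 1 / 2) : ContDiffOn ℝ 2 (swallowingPsi a) (Ioo 0 1) := by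
  rw [show (2 : WithTop ℕ∞) = 1 + 1 from rfl, contDiffOn_succ_iff_deriv_of_isOpen isOpen_Ioo]
  refine ⟨fun u hu ↦ (hasDerivAt_swallowingPsi ha hu).differentiableAt.differentiableWithinAt,
    fun h ↦ absurd h (by decide), ?_⟩
  have h1 : ContDiffOn ℝ 1 (fun u ↦ swallowingKernel a u / swallowingIntegral a 1) (Ioo 0 1) :=
    ((contDiffOn_swallowingKernel a).div_const _).of_le (by exact_mod_cast le_top)
  exact h1.congr fun u hu ↦ (hasDerivAt_swallowingPsi ha hu).deriv

end Psi

variable {κ : ℝ≥0} {x y : ℝ}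

/-! ### The observable before `σ`; levels -/

/-- Before `σ` the observable is `ψ(Zₜ)` with Lawler's `ψ = swallowingPsi (2/κ)` (`κ > 4`,
`y < 0 < x`): `swallowingProb = swallowingPsi` on `[0, 1)` and `Zₜ ∈ (0, 1)`.
[cite: Lawler2005, Prop. 6.33] -/
theorem sleTwoPointObservable_eq_swallowingPsi (hκ : 4 < κ) (hx : 0 < x) (hy : y < 0) {t : ℝ≥0}
    {ω : ℝ≥0 → ℝ} (ht : (t : WithTop ℝ≥0) < twoPointTime (sleDriving κ ω) x y) :
    sleTwoPointObservable κ x y t ω =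
      swallowingPsi (2 / (κ : ℝ)) (twoPointRatio (sleDriving κ ω) x y t) := by
  have ha := two_div_mem_Ioo hκ
  have hZ := sle_twoPointRatio_mem_Ioo hx hy ht
  rw [sleTwoPointObservable_of_lt ht, swallowingProb_eq_swallowingPsi ha.1 ha.2 ⟨hZ.1.le, hZ.2⟩]

/-- From `σ` on, the observable is `0` or `1`. [cite: Lawler2005, Prop. 6.33] -/
theorem sleTwoPointObservable_eq_zero_or_one_of_le {t : ℝ≥0} {ω : ℝ≥0 → ℝ}
    (ht : twoPointTime (sleDriving κ ω) x y ≤ t) :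
    sleTwoPointObservable κ x y t ω = 0 ∨ sleTwoPointObservable κ x y t ω = 1 := by
  by_cases h : swallowingTime (sleDriving κ ω) y < swallowingTime (sleDriving κ ω) x
  · exact Or.inr (sleTwoPointObservable_of_le_of_lt ht h)
  · exact Or.inl (sleTwoPointObservable_of_le_of_not_lt ht h)

/-- **Before `σ` iff the observable is in `(0, 1)`** (one direction): a value of the observable
strictly between `0` and `1` can only occur before `σ`. [cite: Lawler2005, Prop. 6.33] -/
theorem lt_twoPointTime_of_sleTwoPointObservable_mem_Ioo {t : ℝ≥0} {ω : ℝ≥0 → ℝ}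
    (h : sleTwoPointObservable κ x y t ω ∈ Ioo (0 : ℝ) 1) :
    (t : WithTop ℝ≥0) < twoPointTime (sleDriving κ ω) x y := by
  by_contra hle
  rcases sleTwoPointObservable_eq_zero_or_one_of_le (not_lt.1 hle) with h0 | h1
  · exact h.1.ne' h0
  · exact h.2.ne h1

/-- `ψ` is strictly increasing on `[0, 1]`: a value of `ψ(Z)` in `[ψ δ, ψ(1 - δ)]` with
`Z, δ, 1 - δ ∈ [0, 1]` forces `Z ∈ [δ, 1 - δ]`. [folklore] -/
theorem mem_Icc_of_swallowingPsi_mem_Icc {a : ℝ} (ha : a < 1 / 2) {z δ : ℝ} (hz : z ∈ Icc (0 : ℝ) 1)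
    (hδ : δ ∈ Icc (0 : ℝ) 1) (hδ' : 1 - δ ∈ Icc (0 : ℝ) 1)
    (h : swallowingPsi a z ∈ Icc (swallowingPsi a δ) (swallowingPsi a (1 - δ))) :
    z ∈ Icc δ (1 - δ) :=
  ⟨((strictMonoOn_swallowingPsi ha).le_iff_le hδ hz).1 h.1,
    ((strictMonoOn_swallowingPsi ha).le_iff_le hz hδ').1 h.2⟩

section Level

variable (hκ : 4 < κ) (hx : 0 < x) (hy : y < 0) {δ : ℝ} (hδ : 0 < δ) (hδz : δ < x / (x - y))
  (hδz' : x / (x - y) < 1 - δ)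
include hκ hx hy hδ hδz hδz'

/-- The starting value `ψ(x/(x-y))` lies strictly between the levels `ψ δ < ψ(1 - δ)` when
`δ < x/(x - y) < 1 - δ`. [folklore] -/
theorem sleTwoPointObservable_zero_mem_Ioo (ω : ℝ≥0 → ℝ) :
    sleTwoPointObservable κ x y 0 ω ∈
      Ioo (swallowingPsi (2 / (κ : ℝ)) δ) (swallowingPsi (2 / (κ : ℝ)) (1 - δ)) := by
  have ha := two_div_mem_Ioo hκ
  have hz0 : x / (x - y) ∈ Ioo (0 : ℝ) 1 := by
    have hxy : 0 < x - y := by linarith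
    exact ⟨div_pos hx hxy, (div_lt_one hxy).2 (by linarith)⟩
  rw [sleTwoPointObservable_eq_swallowingPsi hκ hx hy (by exact_mod_cast sle_twoPointTime_pos hx hy ω),
    sle_twoPointRatio_zero hx hy]
  have hδ1 : δ ∈ Icc (0 : ℝ) 1 := ⟨hδ.le, by linarith [hz0.2]⟩
  have hδ1' : 1 - δ ∈ Icc (0 : ℝ) 1 := ⟨by linarith [hz0.1], by linarith⟩
  have hzI : x / (x - y) ∈ Icc (0 : ℝ) 1 := ⟨hz0.1.le, hz0.2.le⟩
  exact ⟨strictMonoOn_swallowingPsi ha.2 hδ1 hzI hδz, strictMonoOn_swallowingPsi ha.2 hzI hδ1' hδz'⟩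

/-- **Before the exit of the observable from `(ψ δ, ψ(1-δ))` we are before `σ` and `Z ∈ [δ, 1-δ]`.**
For `↑t ≤ ρ` (`ρ` the exit time of the observable from `(ψ δ, ψ(1 - δ))`): `t < σ` and
`Zₜ ∈ [δ, 1 - δ]`. [cite: Lawler2005, Prop. 6.33] -/
theorem lt_twoPointTime_and_twoPointRatio_mem_Icc {t : ℝ≥0} {ω : ℝ≥0 → ℝ}
    (ht : (t : WithTop ℝ≥0) ≤ Process.exitTime (sleTwoPointObservable κ x y)
      (swallowingPsi (2 / (κ : ℝ)) δ) (swallowingPsi (2 / (κ : ℝ)) (1 - δ)) ω) :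
    (t : WithTop ℝ≥0) < twoPointTime (sleDriving κ ω) x y ∧
      twoPointRatio (sleDriving κ ω) x y t ∈ Icc δ (1 - δ) := by
  have ha := two_div_mem_Ioo hκ
  have hxy : 0 < x - y := by linarith
  have hz0 : x / (x - y) ∈ Ioo (0 : ℝ) 1 := ⟨div_pos hx hxy, (div_lt_one hxy).2 (by linarith)⟩
  have hδ1 : δ ∈ Icc (0 : ℝ) 1 := ⟨hδ.le, by linarith [hz0.2]⟩
  have hδ1' : 1 - δ ∈ Icc (0 : ℝ) 1 := ⟨by linarith [hz0.1], by linarith⟩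
  have hmem := Process.stoppedProcess_exitTime_mem_Icc (continuous_sleTwoPointObservable hκ hx hy ω)
    (sleTwoPointObservable_zero_mem_Ioo hκ hx hy hδ hδz hδz' ω) t
  rw [stoppedProcess_eq_of_le ht] at hmem
  -- the levels are strictly inside `(0, 1)`
  have hlo : 0 < swallowingPsi (2 / (κ : ℝ)) δ := by
    have := strictMonoOn_swallowingPsi ha.2 ⟨le_rfl, zero_le_one⟩ hδ1 hδ
    rwa [swallowingPsi_zero] at this
  have hhi : swallowingPsi (2 / (κ : ℝ)) (1 - δ) < 1 := by
    have := strictMonoOn_swallowingPsi ha.2 hδ1' ⟨zero_le_one, le_rfl⟩ (by linarith)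
    rwa [swallowingPsi_one ha.2] at this
  have hσ : (t : WithTop ℝ≥0) < twoPointTime (sleDriving κ ω) x y :=
    lt_twoPointTime_of_sleTwoPointObservable_mem_Ioo ⟨hlo.trans_le hmem.1, hmem.2.trans_lt hhi⟩
  refine ⟨hσ, ?_⟩
  rw [sleTwoPointObservable_eq_swallowingPsi hκ hx hy hσ] at hmem
  have hZ := sle_twoPointRatio_mem_Ioo hx hy hσ
  exact mem_Icc_of_swallowingPsi_mem_Icc ha.2 ⟨hZ.1.le, hZ.2.le⟩ hδ1 hδ1' hmem

end Level

/-! ### The two real flows before `σ`: positivity, the gap, Lawler's ratio -/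

/-- Before `σ` the frozen flows are the real flows, `X > 0 > Y`, and the gap is at least `x - y`.
[cite: Lawler2005, Prop. 6.33] -/
theorem sleRealFlowStop_facts_of_lt_twoPointTime (hx : 0 < x) (hy : y < 0) {t : ℝ≥0}
    {ω : ℝ≥0 → ℝ} (ht : (t : WithTop ℝ≥0) < twoPointTime (sleDriving κ ω) x y) :
    sleRealFlowStop κ x t ω = realFlow (sleDriving κ ω) x t ∧
      sleRealFlowStop κ y t ω = realFlow (sleDriving κ ω) y t ∧
      0 < sleRealFlowStop κ x t ω ∧ sleRealFlowStop κ y t ω < 0 ∧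
      x - y ≤ sleRealFlowStop κ x t ω - sleRealFlowStop κ y t ω := by
  obtain ⟨htx, hty⟩ := coe_lt_twoPointTime_iff.1 ht
  have hW := continuous_sleDriving κ ω
  have hx' : sleDriving κ ω 0 < x := by rwa [sleDriving_zero]
  have hy' : y < sleDriving κ ω 0 := by rwa [sleDriving_zero]
  have h1 : sleRealFlowStop κ x t ω = realFlow (sleDriving κ ω) x t := realFlowStop_of_lt htx
  have h2 : sleRealFlowStop κ y t ω = realFlow (sleDriving κ ω) y t := realFlowStop_of_lt hty
  refine ⟨h1, h2, ?_, ?_, ?_⟩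
  · rw [h1]; exact realFlow_pos hW hx' htx
  · rw [h2]; exact realFlow_neg hW hy' hty
  · rw [h1, h2]; exact sub_le_realFlow_sub_realFlow hW hx' hy' ht

/-- Before `σ`, Lawler's ratio is `X/(X - Y)` in terms of the frozen flows. [cite: Lawler2005, Prop. 6.33] -/
theorem twoPointRatio_eq_div_of_lt_twoPointTime (hx : 0 < x) (hy : y < 0) {t : ℝ≥0}
    {ω : ℝ≥0 → ℝ} (ht : (t : WithTop ℝ≥0) < twoPointTime (sleDriving κ ω) x y) :
    twoPointRatio (sleDriving κ ω) x y t =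
      sleRealFlowStop κ x t ω / (sleRealFlowStop κ x t ω - sleRealFlowStop κ y t ω) := by
  obtain ⟨h1, h2, -⟩ := sleRealFlowStop_facts_of_lt_twoPointTime (κ := κ) hx hy ht
  rw [twoPointRatio_apply, h1, h2]

/-- **The gap in integrated form** (pathwise): before `σ`,
`Xₜ - Yₜ = (x - y) + ∫₀ᵗ (2/X_s - 2/Y_s) ds` (the driving function cancels; Lawler:
`d[X_t - Y_t] = [a/X_t - a/Y_t] dt`). [cite: Lawler2005, Prop. 6.33] -/
theorem sleRealFlowStop_sub_eq_add_integral (hx : 0 < x) (hy : y < 0) {t : ℝ≥0} {ω : ℝ≥0 → ℝ}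
    (ht : (t : WithTop ℝ≥0) < twoPointTime (sleDriving κ ω) x y) :
    sleRealFlowStop κ x t ω - sleRealFlowStop κ y t ω = (x - y) +
      ∫ s in (0 : ℝ)..t, (2 / sleRealFlowStop κ x s.toNNReal ω - 2 / sleRealFlowStop κ y s.toNNReal ω) := by
  obtain ⟨htx, hty⟩ := coe_lt_twoPointTime_iff.1 ht
  have hW := continuous_sleDriving κ ω
  have hx' : x ≠ sleDriving κ ω 0 := by rw [sleDriving_zero]; exact hx.ne'
  have hy' : y ≠ sleDriving κ ω 0 := by rw [sleDriving_zero]; exact hy.ne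
  have h1 := realFlowStop_eq_sub_add_integral hW hx' htx
  have h2 := realFlowStop_eq_sub_add_integral hW hy' hty
  -- both integrands are continuous on `[0, t]`
  have hcx : ContinuousOn (fun s : ℝ ↦ 2 / sleRealFlowStop κ x s.toNNReal ω) (Icc 0 t) := by
    refine continuousOn_const.div (((continuous_sleRealFlowStop hx.ne' ω).comp
      continuous_real_toNNReal).continuousOn) fun s hs ↦ ?_
    have hs' : ((s.toNNReal : ℝ≥0) : WithTop ℝ≥0) < twoPointTime (sleDriving κ ω) x y :=
      lt_of_le_of_lt (WithTop.coe_le_coe.2 (Real.toNNReal_le_iff_le_coe.2 hs.2)) ht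
    exact (sleRealFlowStop_facts_of_lt_twoPointTime (κ := κ) hx hy hs').2.2.1.ne'
  have hcy : ContinuousOn (fun s : ℝ ↦ 2 / sleRealFlowStop κ y s.toNNReal ω) (Icc 0 t) := by
    refine continuousOn_const.div (((continuous_sleRealFlowStop hy.ne ω).comp
      continuous_real_toNNReal).continuousOn) fun s hs ↦ ?_
    have hs' : ((s.toNNReal : ℝ≥0) : WithTop ℝ≥0) < twoPointTime (sleDriving κ ω) x y :=
      lt_of_le_of_lt (WithTop.coe_le_coe.2 (Real.toNNReal_le_iff_le_coe.2 hs.2)) ht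
    exact (sleRealFlowStop_facts_of_lt_twoPointTime (κ := κ) hx hy hs').2.2.2.1.ne
  rw [intervalIntegral.integral_sub (hcx.intervalIntegrable_of_Icc t.coe_nonneg)
    (hcy.intervalIntegrable_of_Icc t.coe_nonneg)]
  simp only [sleRealFlowStop_apply] at h1 h2 ⊢
  rw [h1, h2]
  ring


/-! ### Bounds on the flows before the exit of the observable from `(ψ δ, ψ(1-δ))` -/

section Bounds

variable (hκ : 4 < κ) (hx : 0 < x) (hy : y < 0) {δ : ℝ} (hδ : 0 < δ) (hδz : δ < x / (x - y))
  (hδz' : x / (x - y) < 1 - δ)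
include hκ hx hy hδ hδz hδz'

/-- Before the exit of the observable from `(ψ δ, ψ(1-δ))`: `X ≥ δ(x-y)` and `-Y ≥ δ(x-y)`
(`X = Z(X - Y)`, `-Y = (1 - Z)(X - Y)`, `Z ∈ [δ, 1-δ]`, `X - Y ≥ x - y`). [cite: Lawler2005, Prop. 6.33] -/
theorem mul_le_sleRealFlowStop_of_le_exitTime {t : ℝ≥0} {ω : ℝ≥0 → ℝ}
    (ht : (t : WithTop ℝ≥0) ≤ Process.exitTime (sleTwoPointObservable κ x y)
      (swallowingPsi (2 / (κ : ℝ)) δ) (swallowingPsi (2 / (κ : ℝ)) (1 - δ)) ω) :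
    δ * (x - y) ≤ sleRealFlowStop κ x t ω ∧ δ * (x - y) ≤ -sleRealFlowStop κ y t ω := by
  obtain ⟨hσ, hZ⟩ := lt_twoPointTime_and_twoPointRatio_mem_Icc hκ hx hy hδ hδz hδz' ht
  obtain ⟨-, -, hXpos, hYneg, hgap⟩ := sleRealFlowStop_facts_of_lt_twoPointTime (κ := κ) hx hy hσ
  have hxy : 0 < x - y := by linarith
  rw [twoPointRatio_eq_div_of_lt_twoPointTime hx hy hσ] at hZ
  set X := sleRealFlowStop κ x t ω
  set Y := sleRealFlowStop κ y t ω
  have hD : 0 < X - Y := by linarith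
  have h1 : X = X / (X - Y) * (X - Y) := by field_simp
  have h2 : -Y = (1 - X / (X - Y)) * (X - Y) := by field_simp; ring
  constructor
  · rw [h1]; exact mul_le_mul hZ.1 hgap hxy.le (hδ.le.trans hZ.1)
  · rw [h2]
    exact mul_le_mul (by linarith [hZ.2]) hgap hxy.le (by linarith [hZ.2])

/-- Before the exit of the observable from `(ψ δ, ψ(1-δ))`, the gap grows at most linearly:
`Xₜ - Yₜ ≤ (x - y) + (4/(δ(x-y))) t` (its time derivative `2/X - 2/Y` is at most `4/(δ(x-y))`).
[cite: Lawler2005, Prop. 6.33] -/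
theorem sleRealFlowStop_sub_le_of_le_exitTime {t : ℝ≥0} {ω : ℝ≥0 → ℝ}
    (ht : (t : WithTop ℝ≥0) ≤ Process.exitTime (sleTwoPointObservable κ x y)
      (swallowingPsi (2 / (κ : ℝ)) δ) (swallowingPsi (2 / (κ : ℝ)) (1 - δ)) ω) :
    sleRealFlowStop κ x t ω - sleRealFlowStop κ y t ω ≤ (x - y) + 4 / (δ * (x - y)) * t := by
  have hσ := (lt_twoPointTime_and_twoPointRatio_mem_Icc hκ hx hy hδ hδz hδz' ht).1
  have hxy : 0 < x - y := by linarith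
  have hc : 0 < δ * (x - y) := mul_pos hδ hxy
  rw [sleRealFlowStop_sub_eq_add_integral hx hy hσ]
  have hbound : ∀ s ∈ Set.uIoc (0 : ℝ) t, ‖2 / sleRealFlowStop κ x s.toNNReal ω -
      2 / sleRealFlowStop κ y s.toNNReal ω‖ ≤ 4 / (δ * (x - y)) := by
    intro s hs
    rw [uIoc_of_le t.coe_nonneg] at hs
    have hs' : ((s.toNNReal : ℝ≥0) : WithTop ℝ≥0) ≤ Process.exitTime (sleTwoPointObservable κ x y)
        (swallowingPsi (2 / (κ : ℝ)) δ) (swallowingPsi (2 / (κ : ℝ)) (1 - δ)) ω :=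
      (WithTop.coe_le_coe.2 (Real.toNNReal_le_iff_le_coe.2 hs.2)).trans ht
    obtain ⟨hX, hY⟩ := mul_le_sleRealFlowStop_of_le_exitTime hκ hx hy hδ hδz hδz' hs'
    set X := sleRealFlowStop κ x s.toNNReal ω
    set Y := sleRealFlowStop κ y s.toNNReal ω
    have hXpos : 0 < X := hc.trans_le hX
    have hYpos : 0 < -Y := hc.trans_le hY
    have h1 : 2 / X ≤ 2 / (δ * (x - y)) := div_le_div_of_nonneg_left zero_le_two hc hX
    have h2 : -(2 / Y) ≤ 2 / (δ * (x - y)) := by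
      rw [show -(2 / Y) = 2 / (-Y) by rw [div_neg]]
      exact div_le_div_of_nonneg_left zero_le_two hc hY
    have h3 : 0 ≤ 2 / X - 2 / Y := by
      have : 0 ≤ 2 / X := by positivity
      have : 2 / Y ≤ 0 := div_nonpos_of_nonneg_of_nonpos zero_le_two (by linarith)
      linarith
    rw [Real.norm_eq_abs, abs_of_nonneg h3]
    have h4 : 4 / (δ * (x - y)) = 2 / (δ * (x - y)) + 2 / (δ * (x - y)) := by ring
    linarith
  have hint := intervalIntegral.norm_integral_le_of_norm_le_const hbound
  rw [Real.norm_eq_abs, sub_zero, abs_of_nonneg t.coe_nonneg] at hint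
  linarith [le_abs_self (∫ s in (0 : ℝ)..t, (2 / sleRealFlowStop κ x s.toNNReal ω -
    2 / sleRealFlowStop κ y s.toNNReal ω))]

end Bounds

/-! ### The stopped observable is a martingale (fixed levels) -/

section Main

/-- A jointly Borel function of two progressive real processes is progressive. [folklore] -/
theorem isStronglyProgressive_comp₂ {Ω : Type*} {m : MeasurableSpace Ω} {𝓕 : Filtration ℝ≥0 m}
    {V U : ℝ≥0 → Ω → ℝ} (hV : IsStronglyProgressive 𝓕 V) (hU : IsStronglyProgressive 𝓕 U)
    {φ : ℝ → ℝ → ℝ} (hφ : Measurable (Function.uncurry φ)) :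
    IsStronglyProgressive 𝓕 fun s ω ↦ φ (V s ω) (U s ω) := fun i ↦
  (hφ.comp ((hV i).measurable.prodMk (hU i).measurable)).stronglyMeasurable

/-- A time-locally bounded integrand has finite `L²(ds ⊗ P)` size on every `[0, t]`. [folklore] -/
theorem lintegral_lintegral_sq_ne_top_of_abs_le {H : ℝ≥0 → (ℝ≥0 → ℝ) → ℝ} {C : ℝ≥0 → ℝ}
    (hH : ∀ (t s : ℝ≥0) ω, s ≤ t → |H s ω| ≤ C t) (t : ℝ≥0) :
    ∫⁻ ω, (∫⁻ s in Set.Icc (0 : ℝ) t, ENNReal.ofReal (H s.toNNReal ω ^ 2)) ∂preWienerMeasure ≠ ∞ := by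
  haveI := isProbabilityMeasure_preWienerMeasure'
  have hle : ∀ ω : ℝ≥0 → ℝ, (∫⁻ s in Set.Icc (0 : ℝ) t, ENNReal.ofReal (H s.toNNReal ω ^ 2)) ≤
      ENNReal.ofReal (C t ^ 2) * volume (Set.Icc (0 : ℝ) t) := by
    intro ω
    rw [← setLIntegral_const]
    refine setLIntegral_mono measurable_const fun s hs ↦ ENNReal.ofReal_le_ofReal ?_
    have h := hH t s.toNNReal ω (Real.toNNReal_le_iff_le_coe.2 hs.2)
    rw [← sq_abs]
    exact pow_le_pow_left₀ (abs_nonneg _) h 2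
  refine ne_top_of_le_ne_top ?_ (lintegral_mono hle)
  rw [lintegral_const, measure_univ, mul_one, Real.volume_Icc, sub_zero]
  exact ENNReal.mul_ne_top ENNReal.ofReal_ne_top ENNReal.ofReal_ne_top

/-- **The algebra of Lawler's (6.21) along `Z = X/(X - Y)`**: with `v = X`, `w = Y`,
`z = v/(v - w)`, `1 - z = -w/(v - w)`, drift `v·(-(2/v - 2/w)/(v-w)²) + (2/v)/(v - w)` and squared
diffusion `κ/(v - w)²` of `Z`, and `ψ' = K/B`, `ψ'' = K(-2a/z + 2a/(1-z))/B`, the Itô drift of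
`ψ(Z)` vanishes when `κ a = 2`. [cite: Lawler2005, eq. (6.21)] -/
theorem lawler_drift_identity {κ a v w K B : ℝ} (hκa : κ * a = 2) (hv : v ≠ 0) (hw : w ≠ 0)
    (hvw : v - w ≠ 0) (hB : B ≠ 0) :
    (v * (-(2 / v - 2 / w) / (v - w) ^ 2) + (v - w)⁻¹ * (2 / v)) * (K / B) +
      2⁻¹ * (κ * ((v - w)⁻¹) ^ 2) *
        (K * (-(2 * a) / (v * (v - w)⁻¹) + 2 * a / (1 - v * (v - w)⁻¹)) / B) = 0 := by
  have hκ : κ ≠ 0 := by rintro rfl; simp at hκa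
  have ha : a = 2 / κ := by rw [eq_div_iff hκ, mul_comm]; exact hκa
  subst ha
  have h1w : 1 - v * (v - w)⁻¹ = -w * (v - w)⁻¹ := by field_simp; ring
  rw [h1w]
  field_simp
  ring

/-- **Lawler's two-point martingale, stopped inside `(0, 1)`.** For `κ > 4`, `y < 0 < x` and a
level `0 < δ` with `δ < x/(x-y) < 1 - δ`, let `ρ` be the exit time of the (continuous, adapted)
two-point observable `M = ψ(Z̃)` from `(ψ δ, ψ(1-δ))` — equivalently of Lawler's ratio `Z` from
`(δ, 1 - δ)`, strictly before `σ`. Then the stopped observable `M^ρ = ψ(Z_{·∧ρ})` is a martingale of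
the raw Brownian filtration. This is the Itô computation of Lawler (2005), proof of Prop. 6.33, made
rigorous as in his footnote 2 / proof of Prop. 1.21: the stopped real flows `X^ρ`, `Y^ρ` are Itô
processes `dX = (2/X)dt - √κ dB`, `dY = (2/Y)dt - √κ dB` (`isItoProcess_stoppedProcess_sleRealFlowStop`);
the gap `X - Y = (x - y) + ∫(2/X - 2/Y) ds` is of finite variation, so `1/(X - Y)` is a time
integral (`inv_eq_inv_add_timeIntegral`); the product rule (`IsItoProcess.mul_timeIntegral`) makes
`Z^ρ = X^ρ/(X^ρ - Y^ρ)` an Itô process with drift `(2/(X-Y)²)(1/Z - 1/(1-Z))` and diffusion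
`-√κ/(X - Y)` before `ρ`; and for a `C²` function `f` equal to `ψ` near `[δ, 1-δ]` the Itô drift
`f'(Z)·drift + ½ f''(Z)·κ/(X-Y)²` vanishes by the hypergeometric equation (6.21)
`u(1-u)ψ'' + (2a - 4au)ψ' = 0`, `a = 2/κ` (`hasDerivAt_swallowingPsi`,
`hasDerivAt_deriv_swallowingPsi`), whence `f(Z^ρ) = M^ρ` is a martingale
(`martingale_apply_of_itoDrift_eq_zero`). [cite: Lawler2005, Prop. 6.33] -/
theorem martingale_stoppedProcess_sleTwoPointObservable (hκ : 4 < κ) (hx : 0 < x) (hy : y < 0)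
    {δ : ℝ} (hδ : 0 < δ) (hδz : δ < x / (x - y)) (hδz' : x / (x - y) < 1 - δ) :
    Martingale (stoppedProcess (sleTwoPointObservable κ x y)
      (Process.exitTime (sleTwoPointObservable κ x y) (swallowingPsi (2 / (κ : ℝ)) δ)
        (swallowingPsi (2 / (κ : ℝ)) (1 - δ)))) brownianFiltration preWienerMeasure := by
  haveI := isProbabilityMeasure_preWienerMeasure'
  have ha := two_div_mem_Ioo hκ
  have hκ0 : (0 : ℝ) < κ := lt_trans (by norm_num) (show (4 : ℝ) < κ by exact_mod_cast hκ)
  have hxy : 0 < x - y := by linarith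
  have hB := swallowingIntegral_one_pos ha.2 (a := 2 / (κ : ℝ))
  set aκ : ℝ := 2 / (κ : ℝ) with haκ
  set O := sleTwoPointObservable κ x y with hOdef
  have hOc : ∀ ω, Continuous fun t ↦ O t ω := continuous_sleTwoPointObservable hκ hx hy
  have hOa : StronglyAdapted brownianFiltration O := stronglyAdapted_sleTwoPointObservable hκ hx hy
  have hOa' : Adapted brownianFiltration O := fun t ↦ (hOa t).measurable
  set ρ := Process.exitTime O (swallowingPsi aκ δ) (swallowingPsi aκ (1 - δ)) with hρdef
  have hρ : IsStoppingTime brownianFiltration ρ := Process.isStoppingTime_exitTime hOa' hOc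
  have hρ' : ∀ t : ℝ≥0, MeasurableSet[brownianFiltration t] {ω | ρ ω < t} :=
    fun t ↦ hρ.measurableSet_lt t
  have hbefore : ∀ ω (t : ℝ≥0), (t : WithTop ℝ≥0) ≤ ρ ω →
      (t : WithTop ℝ≥0) < twoPointTime (sleDriving κ ω) x y ∧
        twoPointRatio (sleDriving κ ω) x y t ∈ Icc δ (1 - δ) := fun ω t ht ↦
    lt_twoPointTime_and_twoPointRatio_mem_Icc hκ hx hy hδ hδz hδz' ht
  -- the two frozen flows and their stopped versions
  set X := sleRealFlowStop κ x with hXdef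
  set Y := sleRealFlowStop κ y with hYdef
  have hXc : ∀ ω, Continuous fun t ↦ X t ω := continuous_sleRealFlowStop hx.ne'
  have hYc : ∀ ω, Continuous fun t ↦ Y t ω := continuous_sleRealFlowStop hy.ne
  have hXprog := isStronglyProgressive_sleRealFlowStop κ hx.ne'
  have hYprog := isStronglyProgressive_sleRealFlowStop κ hy.ne
  have hρX : ∀ ω (t : ℝ≥0), (t : WithTop ℝ≥0) ≤ ρ ω → X t ω ≠ 0 := fun ω t ht ↦
    (sleRealFlowStop_facts_of_lt_twoPointTime (κ := κ) hx hy (hbefore ω t ht).1).2.2.1.ne'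
  have hρY : ∀ ω (t : ℝ≥0), (t : WithTop ℝ≥0) ≤ ρ ω → Y t ω ≠ 0 := fun ω t ht ↦
    (sleRealFlowStop_facts_of_lt_twoPointTime (κ := κ) hx hy (hbefore ω t ht).1).2.2.2.1.ne
  set V := stoppedProcess X ρ with hVdef
  set U := stoppedProcess Y ρ with hUdef
  set σ' : ℝ≥0 → (ℝ≥0 → ℝ) → ℝ := trunc ρ fun _ _ ↦ -Real.sqrt κ with hσ'def
  have hV : IsItoProcess V (trunc ρ fun s ω ↦ 2 / V s ω) σ' brownian brownianFiltration
      preWienerMeasure := isItoProcess_stoppedProcess_sleRealFlowStop hx.ne' hρ hρX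
  have hU : IsItoProcess U (trunc ρ fun s ω ↦ 2 / U s ω) σ' brownian brownianFiltration
      preWienerMeasure := isItoProcess_stoppedProcess_sleRealFlowStop hy.ne hρ hρY
  have hVa : StronglyAdapted brownianFiltration V := hXprog.stronglyAdapted_stoppedProcess hρ
  have hUa : StronglyAdapted brownianFiltration U := hYprog.stronglyAdapted_stoppedProcess hρ
  have hVc : ∀ ω, Continuous (V · ω) := fun ω ↦ Process.continuous_stoppedProcess_path (hXc ω) ρ
  have hUc : ∀ ω, Continuous (U · ω) := fun ω ↦ Process.continuous_stoppedProcess_path (hYc ω) ρ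
  have hVprog : IsStronglyProgressive brownianFiltration V :=
    hVa.isStronglyProgressive_of_continuous hVc
  have hUprog : IsStronglyProgressive brownianFiltration U :=
    hUa.isStronglyProgressive_of_continuous hUc
  have hσ' : IsStronglyProgressive brownianFiltration σ' :=
    isStronglyProgressive_trunc (isStronglyProgressive_const _ _) hρ'
  have hσ'bd : ∀ t ω, |σ' t ω| ≤ Real.sqrt κ := by
    intro t ω
    simp only [hσ'def, trunc_apply]
    split_ifs
    · rw [abs_neg, abs_of_nonneg (Real.sqrt_nonneg _)]
    · rw [abs_zero]; exact Real.sqrt_nonneg _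
  -- the stopped clock
  have hclock : ∀ ω (t : ℝ≥0), ((min (t : WithTop ℝ≥0) (ρ ω)).untopA : WithTop ℝ≥0) ≤ ρ ω :=
    fun ω t ↦ coe_untopA_min_le t (ρ ω)
  have hVU : ∀ ω t, 0 < V t ω ∧ U t ω < 0 ∧ x - y ≤ V t ω - U t ω := by
    intro ω t
    have h := sleRealFlowStop_facts_of_lt_twoPointTime (κ := κ) hx hy (hbefore ω _ (hclock ω t)).1
    exact ⟨h.2.2.1, h.2.2.2.1, h.2.2.2.2⟩
  have hVbd : ∀ (t s : ℝ≥0) ω, s ≤ t → |V s ω| ≤ (x - y) + 4 / (δ * (x - y)) * t := by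
    intro t s ω hst
    have h1 := hVU ω s
    have h2 := sleRealFlowStop_sub_le_of_le_exitTime hκ hx hy hδ hδz hδz' (hclock ω s)
    have h3 : ((min (s : WithTop ℝ≥0) (ρ ω)).untopA : ℝ) ≤ t :=
      NNReal.coe_le_coe.2 ((untopA_min_le s (ρ ω)).trans hst)
    have h4 : 0 ≤ 4 / (δ * (x - y)) := by positivity
    rw [abs_of_pos h1.1]
    change X _ ω - Y _ ω ≤ _ at h2
    have h5 : V s ω - U s ω ≤ (x - y) + 4 / (δ * (x - y)) * t :=
      h2.trans (by nlinarith)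
    linarith [h1.2.1]
  -- the gap in integrated form
  set Gp : ℝ≥0 → (ℝ≥0 → ℝ) → ℝ := fun s ω ↦ 2 / V s ω - 2 / U s ω with hGpdef
  have hgap : ∀ ω t, V t ω - U t ω = (x - y) + timeIntegral (trunc ρ Gp) t ω := by
    intro ω t
    set u : ℝ≥0 := (min (t : WithTop ℝ≥0) (ρ ω)).untopA with hu
    have huσ := (hbefore ω u (hclock ω t)).1
    have h1 := sleRealFlowStop_sub_eq_add_integral (κ := κ) hx hy huσ
    rw [timeIntegral_trunc]
    change X u ω - Y u ω = (x - y) + ∫ s in (0 : ℝ)..u, Gp s.toNNReal ω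
    rw [h1]
    congr 1
    refine intervalIntegral.integral_congr fun s hs ↦ ?_
    rw [uIcc_of_le u.coe_nonneg] at hs
    have hsρ : (s.toNNReal : WithTop ℝ≥0) ≤ ρ ω :=
      (WithTop.coe_le_coe.2 (Real.toNNReal_le_iff_le_coe.2 hs.2)).trans (hclock ω t)
    simp only [hGpdef, hVdef, hUdef, stoppedProcess_eq_of_le hsρ, hXdef, hYdef]
  -- the factor `A = 1/(V - U)` and its time derivative `a`
  set A : ℝ≥0 → (ℝ≥0 → ℝ) → ℝ := fun t ω ↦ (V t ω - U t ω)⁻¹ with hAdef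
  set a : ℝ≥0 → (ℝ≥0 → ℝ) → ℝ := trunc ρ fun s ω ↦ -Gp s ω / (V s ω - U s ω) ^ 2 with hadef
  have hGpc : ∀ ω, Continuous fun s ↦ Gp s ω := fun ω ↦
    (continuous_const.div (hVc ω) fun s ↦ (hVU ω s).1.ne').sub
      (continuous_const.div (hUc ω) fun s ↦ (hVU ω s).2.1.ne)
  have hArep : ∀ ω t, A t ω = A 0 ω + ∫ s in (0 : ℝ)..t, a s.toNNReal ω := by
    intro ω t
    have hpos : ∀ s, 0 < (x - y) + timeIntegral (trunc ρ Gp) s ω := fun s ↦ by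
      rw [← hgap ω s]; linarith [(hVU ω s).2.2]
    have h := inv_eq_inv_add_timeIntegral (hGpc ω) hpos t
    have h0 : A 0 ω = (x - y)⁻¹ := by
      simp only [hAdef, hVdef, hUdef, stoppedProcess_eq_of_le (coe_zero_le_withTop _), hXdef, hYdef]
      rw [sleRealFlowStop_zero_apply hx.ne', sleRealFlowStop_zero_apply hy.ne]
    have hfun : (trunc ρ fun s ω ↦ -Gp s ω / ((x - y) + timeIntegral (trunc ρ Gp) s ω) ^ 2) = a := by
      simp only [hadef]
      congr 1
      funext s ω
      rw [← hgap ω s]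
    have hAt : A t ω = ((x - y) + timeIntegral (trunc ρ Gp) t ω)⁻¹ := by
      simp only [hAdef]; rw [hgap ω t]
    rw [hAt, h, h0, hfun]
    rfl
  have ha_int : ∀ ω (t : ℝ≥0), IntegrableOn (fun s : ℝ ↦ a s.toNNReal ω) (Icc 0 t) := by
    intro ω t
    refine integrableOn_trunc ?_
    have hc : Continuous fun s : ℝ ↦ -Gp s.toNNReal ω / (V s.toNNReal ω - U s.toNNReal ω) ^ 2 :=
      ((hGpc ω).comp continuous_real_toNNReal).neg.div
        ((((hVc ω).sub (hUc ω)).comp continuous_real_toNNReal).pow 2)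
        fun s ↦ (pow_pos (hxy.trans_le (hVU ω _).2.2) 2).ne'
    exact hc.continuousOn.integrableOn_compact isCompact_Icc
  have hAbd : ∀ t ω, |A t ω| ≤ (x - y)⁻¹ := by
    intro t ω
    have hd := (hVU ω t).2.2
    simp only [hAdef]
    rw [abs_of_pos (inv_pos.2 (hxy.trans_le hd))]
    exact inv_anti₀ hxy hd
  have hAa : StronglyAdapted brownianFiltration A := fun t ↦
    ((hVa t).measurable.sub (hUa t).measurable).inv.stronglyMeasurable
  have hAc : ∀ ω, Continuous (A · ω) := fun ω ↦
    ((hVc ω).sub (hUc ω)).inv₀ fun s ↦ (hxy.trans_le (hVU ω s).2.2).ne'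
  have hAprog : IsStronglyProgressive brownianFiltration A :=
    hAa.isStronglyProgressive_of_continuous hAc
  -- the Itô integrals of `σ'V` and `σ'A`
  obtain ⟨KX, hKX, hKXM, -⟩ := exists_isItoIntegral_of_sq_integrable (hσ'.mul hVprog)
    (lintegral_lintegral_sq_ne_top_of_abs_le
      (C := fun t ↦ Real.sqrt κ * ((x - y) + 4 / (δ * (x - y)) * t)) fun t s ω hst ↦ by
        rw [abs_mul]
        exact mul_le_mul (hσ'bd s ω) (hVbd t s ω hst) (abs_nonneg _) (Real.sqrt_nonneg _))
  obtain ⟨K, hK, hKM, -⟩ := exists_isItoIntegral_of_sq_integrable (hσ'.mul hAprog)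
    (lintegral_lintegral_sq_ne_top_of_abs_le (C := fun _ ↦ Real.sqrt κ * (x - y)⁻¹)
      fun t s ω _ ↦ by
        rw [abs_mul]
        exact mul_le_mul (hσ'bd s ω) (hAbd s ω) (abs_nonneg _) (Real.sqrt_nonneg _))
  -- the product rule: `Z^ρ = V A` is an Itô process
  have hZ := IsItoProcess.mul_timeIntegral hVa hVc hσ' hV hAa hAc
    (ae_of_all _ fun ω t ↦ hArep ω t) (ae_of_all _ fun ω t ↦ ha_int ω t) hKX hKXM hK hKM
  -- `Z^ρ` is Lawler's ratio at the stopped clock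
  have hZeq : ∀ ω t, V t ω * A t ω =
      twoPointRatio (sleDriving κ ω) x y ((min (t : WithTop ℝ≥0) (ρ ω)).untopA) := by
    intro ω t
    rw [twoPointRatio_eq_div_of_lt_twoPointTime hx hy (hbefore ω _ (hclock ω t)).1]
    simp only [hAdef, hVdef, hUdef, stoppedProcess, div_eq_mul_inv, hXdef, hYdef]
  have hZmem : ∀ t ω, V t ω * A t ω ∈ Icc δ (1 - δ) := fun t ω ↦ by
    rw [hZeq ω t]; exact (hbefore ω _ (hclock ω t)).2
  have hZa : StronglyAdapted brownianFiltration fun t ω ↦ V t ω * A t ω := fun t ↦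
    (hVa t).mul (hAa t)
  have hZc : ∀ ω, Continuous fun t ↦ V t ω * A t ω := fun ω ↦ (hVc ω).mul (hAc ω)
  have hZ0 : ∀ ω, V 0 ω * A 0 ω = x / (x - y) := fun ω ↦ by
    rw [hZeq ω 0]
    have : (min ((0 : ℝ≥0) : WithTop ℝ≥0) (ρ ω)).untopA = 0 := by
      rw [min_eq_left (coe_zero_le_withTop _)]; rfl
    rw [this, sle_twoPointRatio_zero hx hy]
  -- progressivity of the coefficients of `Z^ρ`
  have hmeasφ : Measurable (Function.uncurry fun v u : ℝ ↦ -(2 / v - 2 / u) / (v - u) ^ 2) :=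
    ((measurable_const.div measurable_fst).sub (measurable_const.div measurable_snd)).neg.div
      ((measurable_fst.sub measurable_snd).pow_const 2)
  have haprog : IsStronglyProgressive brownianFiltration a :=
    isStronglyProgressive_trunc (isStronglyProgressive_comp₂ hVprog hUprog hmeasφ) hρ'
  have hbV : IsStronglyProgressive brownianFiltration (trunc ρ fun s ω ↦ 2 / V s ω) :=
    isStronglyProgressive_trunc (IsStronglyProgressive.comp_measurable₂ hVprog
      (F := fun _ v ↦ 2 / v) (measurable_const.div measurable_snd)) hρ'
  have hbZ : IsStronglyProgressive brownianFiltration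
      fun t ω ↦ V t ω * a t ω + A t ω * trunc ρ (fun s ω ↦ 2 / V s ω) t ω :=
    (hVprog.mul haprog).add (hAprog.mul hbV)
  have hσZ : IsStronglyProgressive brownianFiltration fun t ω ↦ σ' t ω * A t ω := hσ'.mul hAprog
  have hσZbd : ∀ t ω, |σ' t ω * A t ω| ≤ Real.sqrt κ * (x - y)⁻¹ := fun t ω ↦ by
    rw [abs_mul]; exact mul_le_mul (hσ'bd t ω) (hAbd t ω) (abs_nonneg _) (Real.sqrt_nonneg _)
  -- a `C²` function equal to `ψ` on `[δ/2, 1 - δ/2]`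
  have hδ1 : 1 - δ < 1 := by linarith
  have hz0 : x / (x - y) ∈ Ioo (0 : ℝ) 1 := ⟨div_pos hx hxy, (div_lt_one hxy).2 (by linarith)⟩
  obtain ⟨f, hf, hfeq, -⟩ := exists_contDiff_eqOn_Icc (n := 2) (a := 0) (b := 1) (lo := δ / 2)
    (hi := 1 - δ / 2) (by linarith) (by linarith [hz0.1, hz0.2]) (by linarith)
    (contDiffOn_swallowingPsi ha.2 (a := aκ))
  have hfnhds : ∀ z ∈ Icc δ (1 - δ), f =ᶠ[𝓝 z] swallowingPsi aκ := by
    intro z hz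
    have hmem : Ioo (δ / 2) (1 - δ / 2) ∈ 𝓝 z := Ioo_mem_nhds (by linarith [hz.1]) (by linarith [hz.2])
    filter_upwards [hmem] with u hu
    exact hfeq (Ioo_subset_Icc_self hu)
  have hzI : ∀ z ∈ Icc δ (1 - δ), z ∈ Ioo (0 : ℝ) 1 := fun z hz ↦
    ⟨hδ.trans_le hz.1, hz.2.trans_lt hδ1⟩
  have hd1 : ∀ z ∈ Icc δ (1 - δ), deriv f z = swallowingKernel aκ z / swallowingIntegral aκ 1 := by
    intro z hz
    rw [(hfnhds z hz).deriv_eq]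
    exact (hasDerivAt_swallowingPsi ha.2 (hzI z hz)).deriv
  have hd2 : ∀ z ∈ Icc δ (1 - δ), iteratedDeriv 2 f z =
      swallowingKernel aκ z * (-(2 * aκ) / z + 2 * aκ / (1 - z)) / swallowingIntegral aκ 1 := by
    intro z hz
    rw [iteratedDeriv_succ, iteratedDeriv_one]
    have h1 : deriv f =ᶠ[𝓝 z] fun u ↦ swallowingKernel aκ u / swallowingIntegral aκ 1 := by
      have hmem : Ioo (δ / 2) (1 - δ / 2) ∈ 𝓝 z :=
        Ioo_mem_nhds (by linarith [hz.1]) (by linarith [hz.2])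
      filter_upwards [(hfnhds z hz).deriv, hmem] with u hu hu'
      rw [hu]
      exact (hasDerivAt_swallowingPsi ha.2 ⟨by linarith [hu'.1], by linarith [hu'.2]⟩).deriv
    rw [h1.deriv_eq]
    exact (hasDerivAt_deriv_swallowingPsi aκ (hzI z hz)).deriv
  -- the Itô drift of `f` along `Z^ρ` vanishes (the hypergeometric equation (6.21))
  have hdrift : ∀ s ω, (V s ω * a s ω + A s ω * trunc ρ (fun s ω ↦ 2 / V s ω) s ω) *
      deriv f (V s ω * A s ω) +
      2⁻¹ * (σ' s ω * A s ω) ^ 2 * iteratedDeriv 2 f (V s ω * A s ω) = 0 := by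
    intro s ω
    by_cases hs : (s : WithTop ℝ≥0) ≤ ρ ω
    · have hz := hZmem s ω
      rw [hd1 _ hz, hd2 _ hz]
      simp only [hadef, hσ'def, hGpdef, trunc_of_le hs, hAdef]
      obtain ⟨hv, hw, hd⟩ := hVU ω s
      set v := V s ω
      set w := U s ω
      have hvne : v ≠ 0 := hv.ne'
      have hwne : w ≠ 0 := hw.ne
      have hdne : v - w ≠ 0 := by linarith
      have hκa : (κ : ℝ) * aκ = 2 := by rw [haκ]; field_simp
      rw [mul_pow, neg_sq, Real.sq_sqrt κ.coe_nonneg]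
      exact lawler_drift_identity hκa hvne hwne hdne hB.ne'
    · simp only [hadef, hσ'def, trunc_of_not_le hs]
      simp
  have hmart := martingale_apply_of_itoDrift_eq_zero hf hZa hZc hbZ hσZ hZ hZ0 hZmem hσZbd hdrift
  -- identify `f(Z^ρ)` with the stopped observable
  have heq : stoppedProcess O ρ = fun t ω ↦ f (V t ω * A t ω) := by
    funext t ω
    have hu := hclock ω t
    have hσ := (hbefore ω _ hu).1
    have hz := (hbefore ω _ hu).2
    rw [hZeq ω t, hfeq ⟨by linarith [hz.1], by linarith [hz.2]⟩]
    exact sleTwoPointObservable_eq_swallowingPsi hκ hx hy hσ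
  rw [heq]
  exact hmart

end Main

/-! ### Letting the levels tend to `0` and `1` -/

section Limit

/-- A sequence each of whose terms is one of two values `pₙ ∈ {αₙ, βₙ}` with `αₙ(1-αₙ) → 0`,
`βₙ(1-βₙ) → 0`, `0 ≤ pₙ ≤ 1`, and `pₙ → L`, has `L(1 - L) = 0`. [folklore] -/
theorem mul_one_sub_eq_zero_of_tendsto {p α β : ℕ → ℝ} {L : ℝ} (hp : ∀ n, p n = α n ∨ p n = β n)
    (hα : Tendsto (fun n ↦ α n * (1 - α n)) atTop (𝓝 0))
    (hβ : Tendsto (fun n ↦ β n * (1 - β n)) atTop (𝓝 0)) (hL : Tendsto p atTop (𝓝 L)) :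
    L * (1 - L) = 0 := by
  have h1 : Tendsto (fun n ↦ p n * (1 - p n)) atTop (𝓝 (L * (1 - L))) :=
    hL.mul (tendsto_const_nhds.sub hL)
  have h2 : Tendsto (fun n ↦ |p n * (1 - p n)|) atTop (𝓝 0) := by
    have hsum : Tendsto (fun n ↦ |α n * (1 - α n)| + |β n * (1 - β n)|) atTop (𝓝 0) := by
      simpa using (continuous_abs.tendsto 0 |>.comp hα).add (continuous_abs.tendsto 0 |>.comp hβ)
    refine squeeze_zero (fun n ↦ abs_nonneg _) (fun n ↦ ?_) hsum
    rcases hp n with h | h <;> rw [h]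
    · exact le_add_of_nonneg_right (abs_nonneg _)
    · exact le_add_of_nonneg_left (abs_nonneg _)
  have h3 : Tendsto (fun n ↦ |p n * (1 - p n)|) atTop (𝓝 |L * (1 - L)|) :=
    (continuous_abs.tendsto _).comp h1
  have := tendsto_nhds_unique h3 h2
  exact abs_eq_zero.1 this

/-- `ψ(rₙ)(1 - ψ(rₙ)) → 0` when `rₙ → r ∈ {0, 1}` within `[0, 1]` (`ψ` is continuous on `[0, 1]`
with `ψ(0) = 0`, `ψ(1) = 1`). [folklore] -/
theorem tendsto_swallowingPsi_mul_one_sub {a : ℝ} (ha : a < 1 / 2) {r : ℕ → ℝ} {r₀ : ℝ}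
    (hr : ∀ n, r n ∈ Icc (0 : ℝ) 1) (hr₀ : r₀ = 0 ∨ r₀ = 1) (hlim : Tendsto r atTop (𝓝 r₀)) :
    Tendsto (fun n ↦ swallowingPsi a (r n) * (1 - swallowingPsi a (r n))) atTop (𝓝 0) := by
  have hmem : r₀ ∈ Icc (0 : ℝ) 1 := by rcases hr₀ with h | h <;> rw [h] <;> simp
  have hcont := (continuousOn_swallowingPsi ha) r₀ hmem
  have h1 : Tendsto (fun n ↦ swallowingPsi a (r n)) atTop (𝓝 (swallowingPsi a r₀)) :=
    hcont.tendsto.comp (tendsto_nhdsWithin_iff.2 ⟨hlim, Eventually.of_forall hr⟩)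
  have h2 : swallowingPsi a r₀ * (1 - swallowingPsi a r₀) = 0 := by
    rcases hr₀ with h | h
    · rw [h, swallowingPsi_zero]; ring
    · rw [h, swallowingPsi_one ha]; ring
  have h3 := h1.mul ((tendsto_const_nhds (x := (1 : ℝ))).sub h1)
  rwa [h2] at h3

variable {κ : ℝ≥0} {x y : ℝ}

/-- **The stopped observables converge to the observable as the levels tend to `0` and `1`**
(every path and time). Let `δₙ ↓ 0` with `δₙ < x/(x-y) < 1 - δₙ` and `ρₙ` the exit time of the
observable `M` from `(ψ δₙ, ψ(1-δₙ))`. If `t ≤ ρₙ` for some `n` the stopped values are eventually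
`M_t`. Otherwise the finite exit times `ρₙ < t` increase to a limit `ℓ ≤ t` with
`M_{ρₙ} ∈ {ψ δₙ, ψ(1-δₙ)}`, so `M_ℓ(1 - M_ℓ) = 0`, i.e. `M_ℓ ∈ {0, 1}`, forcing `σ ≤ ℓ`; and `M`
is constant (the crossing indicator) on `[σ, ∞) ∋ ℓ, t`. [cite: Lawler2005, Prop. 6.33] -/
theorem tendsto_stoppedProcess_sleTwoPointObservable (hκ : 4 < κ) (hx : 0 < x) (hy : y < 0)
    {δ : ℕ → ℝ} (hδanti : Antitone δ) (hδpos : ∀ n, 0 < δ n) (hδz : ∀ n, δ n < x / (x - y))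
    (hδz' : ∀ n, x / (x - y) < 1 - δ n) (hδlim : Tendsto δ atTop (𝓝 0)) (t : ℝ≥0) (ω : ℝ≥0 → ℝ) :
    Tendsto (fun n ↦ stoppedProcess (sleTwoPointObservable κ x y)
      (Process.exitTime (sleTwoPointObservable κ x y) (swallowingPsi (2 / (κ : ℝ)) (δ n))
        (swallowingPsi (2 / (κ : ℝ)) (1 - δ n))) t ω) atTop
      (𝓝 (sleTwoPointObservable κ x y t ω)) := by
  have ha := two_div_mem_Ioo hκ
  have hxy : 0 < x - y := by linarith
  have hz0 : x / (x - y) ∈ Ioo (0 : ℝ) 1 := ⟨div_pos hx hxy, (div_lt_one hxy).2 (by linarith)⟩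
  set O := sleTwoPointObservable κ x y with hOdef
  have hOc : Continuous fun s ↦ O s ω := continuous_sleTwoPointObservable hκ hx hy ω
  set ρ : ℕ → WithTop ℝ≥0 := fun n ↦ Process.exitTime O (swallowingPsi (2 / (κ : ℝ)) (δ n))
    (swallowingPsi (2 / (κ : ℝ)) (1 - δ n)) ω with hρdef
  set u : ℕ → ℝ≥0 := fun n ↦ (min (t : WithTop ℝ≥0) (ρ n)).untopA with hudef
  have hδI : ∀ n, δ n ∈ Icc (0 : ℝ) 1 := fun n ↦ ⟨(hδpos n).le, by linarith [hδz n, hz0.2]⟩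
  have hδI' : ∀ n, 1 - δ n ∈ Icc (0 : ℝ) 1 := fun n ↦ ⟨by linarith [hδz' n, hz0.1], by linarith [hδpos n]⟩
  -- monotonicity of the exit times (the intervals increase)
  have hρmono : Monotone ρ := by
    intro n m hnm
    have hsub : Ioo (swallowingPsi (2 / (κ : ℝ)) (δ n)) (swallowingPsi (2 / (κ : ℝ)) (1 - δ n)) ⊆
        Ioo (swallowingPsi (2 / (κ : ℝ)) (δ m)) (swallowingPsi (2 / (κ : ℝ)) (1 - δ m)) :=
      Ioo_subset_Ioo ((strictMonoOn_swallowingPsi ha.2).monotoneOn (hδI m) (hδI n) (hδanti hnm))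
        ((strictMonoOn_swallowingPsi ha.2).monotoneOn (hδI' n) (hδI' m) (by linarith [hδanti hnm]))
    have := hittingAfter_anti O 0 (compl_subset_compl.2 hsub) ω
    simpa only [hρdef, Process.exitTime_def] using this
  have humono : Monotone u := fun n m hnm ↦ untopA_min_coe_mono (hρmono hnm)
  have hut : ∀ n, u n ≤ t := fun n ↦ untopA_min_le t (ρ n)
  -- the stopped value is `O (u n)`
  have hval : ∀ n, stoppedProcess O (Process.exitTime O (swallowingPsi (2 / (κ : ℝ)) (δ n))
      (swallowingPsi (2 / (κ : ℝ)) (1 - δ n))) t ω = O (u n) ω := fun n ↦ rfl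
  simp only [hval]
  by_cases hcase : ∃ n, (t : WithTop ℝ≥0) ≤ ρ n
  · -- eventually `u n = t`
    obtain ⟨n, hn⟩ := hcase
    refine tendsto_const_nhds.congr' ?_
    filter_upwards [eventually_ge_atTop n] with m hm
    have htm : (t : WithTop ℝ≥0) ≤ ρ m := hn.trans (hρmono hm)
    show O t ω = O (u m) ω
    simp only [hudef, min_eq_left htm]
    rfl
  · simp only [not_exists, not_le] at hcase
    -- all exit times are finite, `ρ n = u n < t`
    have hρeq : ∀ n, ρ n = (u n : WithTop ℝ≥0) := by
      intro n
      have h1 : min (t : WithTop ℝ≥0) (ρ n) = (u n : WithTop ℝ≥0) := (coe_untopA_min t (ρ n)).symm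
      rwa [min_eq_right (hcase n).le] at h1
    have hbdd : BddAbove (range u) := ⟨t, by rintro _ ⟨n, rfl⟩; exact hut n⟩
    set ℓ := ⨆ n, u n with hℓdef
    have hulim : Tendsto u atTop (𝓝 ℓ) := tendsto_atTop_ciSup humono hbdd
    have hℓt : ℓ ≤ t := ciSup_le hut
    -- `O (u n) ∈ {ψ(δ n), ψ(1 - δ n)}`
    have h0n : ∀ n, O 0 ω ∈ Ioo (swallowingPsi (2 / (κ : ℝ)) (δ n))
        (swallowingPsi (2 / (κ : ℝ)) (1 - δ n)) := fun n ↦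
      sleTwoPointObservable_zero_mem_Ioo hκ hx hy (hδpos n) (hδz n) (hδz' n) ω
    have hends : ∀ n, O (u n) ω = swallowingPsi (2 / (κ : ℝ)) (δ n) ∨
        O (u n) ω = swallowingPsi (2 / (κ : ℝ)) (1 - δ n) := fun n ↦
      Process.apply_eq_or_eq_of_exitTime_eq_coe hOc (h0n n) (hρeq n)
    have hOlim : Tendsto (fun n ↦ O (u n) ω) atTop (𝓝 (O ℓ ω)) := (hOc.tendsto ℓ).comp hulim
    have hℓval : O ℓ ω * (1 - O ℓ ω) = 0 :=
      mul_one_sub_eq_zero_of_tendsto hends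
        (tendsto_swallowingPsi_mul_one_sub ha.2 hδI (Or.inl rfl) hδlim)
        (tendsto_swallowingPsi_mul_one_sub ha.2 hδI' (Or.inr rfl)
          (by simpa using tendsto_const_nhds.sub hδlim)) hOlim
    -- hence `σ ≤ ℓ`, and `O` is constant from `σ` on
    have hσℓ : twoPointTime (sleDriving κ ω) x y ≤ ℓ := by
      by_contra hlt
      rw [not_le] at hlt
      have hmem : O ℓ ω ∈ Ioo (0 : ℝ) 1 := by
        rw [hOdef, sleTwoPointObservable_eq_swallowingPsi hκ hx hy hlt]
        exact swallowingPsi_mem_Ioo ha.2 (sle_twoPointRatio_mem_Ioo hx hy hlt)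
      rcases mul_eq_zero.1 hℓval with h | h
      · exact hmem.1.ne' h
      · exact hmem.2.ne (by linarith)
    have hOt : O t ω = O ℓ ω := by
      rw [hOdef, sleTwoPointObservable_of_le (hσℓ.trans (WithTop.coe_le_coe.2 hℓt)),
        sleTwoPointObservable_of_le hσℓ]
    rw [hOt]
    exact hOlim

end Limit

/-! ### The named fact and Cardy's formula -/

section Facts

/-- **Lawler's two-point martingale, `sle_martingale_twoPointObservable` proved** (Lawler (2005),
§6.7, proof of Prop. 6.33 with footnote 2 / proof of Prop. 1.21): for `κ > 4` and `y < 0 < x`, the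
two-point observable `ψ(Z_{t∧σ})` (regularised from `σ` on) is a martingale of the raw Brownian
filtration. It is the bounded (by `1`) pointwise limit of the stopped observables of
`martingale_stoppedProcess_sleTwoPointObservable` for the levels `δₙ = δ₀/(n+2)`,
`δ₀ = min(z₀, 1 - z₀)`, `z₀ = x/(x-y)` (`tendsto_stoppedProcess_sleTwoPointObservable`,
`martingale_of_tendsto_of_abs_le'`). [cite: Lawler2005, Prop. 6.33] -/
theorem sle_martingale_twoPointObservable_holds : sle_martingale_twoPointObservable := by
  intro κ hκ x y hx hy
  haveI := isProbabilityMeasure_preWienerMeasure'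
  have hxy : 0 < x - y := by linarith
  have hz0 : x / (x - y) ∈ Ioo (0 : ℝ) 1 := ⟨div_pos hx hxy, (div_lt_one hxy).2 (by linarith)⟩
  set δ₀ : ℝ := min (x / (x - y)) (1 - x / (x - y)) with hδ₀
  have hδ₀pos : 0 < δ₀ := lt_min hz0.1 (by linarith [hz0.2])
  set δ : ℕ → ℝ := fun n ↦ δ₀ / ((n : ℝ) + 2) with hδdef
  have hδpos : ∀ n, 0 < δ n := fun n ↦ by positivity
  have hδlt : ∀ n, δ n < δ₀ := fun n ↦ by
    rw [hδdef]; dsimp only; rw [div_lt_iff₀ (by positivity)]; nlinarith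
  have hδz : ∀ n, δ n < x / (x - y) := fun n ↦ (hδlt n).trans_le (min_le_left _ _)
  have hδz' : ∀ n, x / (x - y) < 1 - δ n := fun n ↦ by
    have := (hδlt n).trans_le (min_le_right _ _); linarith
  have hδanti : Antitone δ := fun n m hnm ↦ by
    apply div_le_div_of_nonneg_left hδ₀pos.le (by positivity)
    exact_mod_cast Nat.add_le_add_right hnm 2
  have hδlim : Tendsto δ atTop (𝓝 0) := by
    have h1 : Tendsto (fun n : ℕ ↦ (n : ℝ) + 2) atTop atTop :=
      tendsto_natCast_atTop_atTop.atTop_add tendsto_const_nhds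
    exact h1.const_div_atTop δ₀ |>.congr fun n ↦ rfl
  have hM : ∀ n, Martingale (stoppedProcess (sleTwoPointObservable κ x y)
      (Process.exitTime (sleTwoPointObservable κ x y) (swallowingPsi (2 / (κ : ℝ)) (δ n))
        (swallowingPsi (2 / (κ : ℝ)) (1 - δ n)))) brownianFiltration preWienerMeasure := fun n ↦
    martingale_stoppedProcess_sleTwoPointObservable hκ hx hy (hδpos n) (hδz n) (hδz' n)
  refine martingale_of_tendsto_of_abs_le' hM (C := fun _ ↦ 1) (fun n t ω ↦ ?_) fun t ω ↦
    tendsto_stoppedProcess_sleTwoPointObservable hκ hx hy hδanti hδpos hδz hδz' hδlim t ω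
  simp only [stoppedProcess]
  have h := sleTwoPointObservable_mem_Icc hκ hx hy ((min (t : WithTop ℝ≥0)
    (Process.exitTime (sleTwoPointObservable κ x y) (swallowingPsi (2 / (κ : ℝ)) (δ n))
      (swallowingPsi (2 / (κ : ℝ)) (1 - δ n)) ω)).untopA) ω
  rw [abs_le]
  exact ⟨by linarith [h.1], h.2⟩

/-- **Cardy's formula for SLE₆ in a conformal rectangle: `sle_six_measureReal_hitsBefore` proved.**
Chordal SLE₆ from `a` to `c` in the conformal rectangle `(Ω; a, b, c, d)` hits the arc `(cd)` before
the arc `(bc)` with probability `F(η)`, Cardy's function of the cross-ratio of any uniformizing datum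
(Werner (2007), §3; Lawler–Schramm–Werner (2001); Smirnov (2001)). Assembled by
`CritPerc.sle_six_measureReal_hitsBefore_of_itoSteps` (`SLEOnePointSwallowingProofs`) from the three
Itô steps now proved in the tree: Lawler's two-point martingale
(`sle_martingale_twoPointObservable_holds`, this file; Lawler (2005), Prop. 6.33) and the two
one-point martingales (`sle_martingale_onePointPow_holds`, `sle_martingale_onePointSq_holds`,
`SLEOnePointMartingaleProofs`; Lawler (2005), Prop. 1.21 / 6.8), every other ingredient — the Loewner
flow, the locality/transport of SLE₆ to the rectangle (`CritPercSLEProofs`,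
`CritPercSLELocalityProofs`), the crossing probability `P{T_y < T_x} = Ψ(x/(x-y))` and its
identification with Cardy's function (`SLECrossingProbabilityProofs`, `SwallowingProbCalculus`),
a.s. swallowing of real points for `κ > 4` (`SLEOnePointSwallowingProofs`), the Itô calculus
(`ItoFormulaProofs`, `ItoIntegralLocalization`, …) — having been proved there before.
[cite: Werner2007, §3] -/
theorem sle_six_measureReal_hitsBefore_holds : sle_six_measureReal_hitsBefore :=
  sle_six_measureReal_hitsBefore_of_itoSteps sle_martingale_twoPointObservable_holds
    sle_martingale_onePointPow_holds sle_martingale_onePointSq_holds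

end Facts

end Literature.Probability.RandomPlanarGeometry
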